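import Summits.RiemannHypothesis.RiemannHypothesis.Theorems.MotivicDoorCastelnuovoSeveri

/-!
# Motivic door (cell `pub-rhdoor`, seat cc-3): hypothesis (2) of the Essay's Lemma 2.1, on
Connes–Consani's own divisors and rulings, IS Weil positivity

A. Connes, *An essay on the Riemann Hypothesis* (2016) §2.3 [Connes2016EssayRH], p. 8 of
arXiv:1509.05576, transcribes Weil's `C̄ × C̄` proof as: Riemann–Roch inequality (12) + "three basic
facts" — (1) `ℓ(D) > 1 ⟹ D ∼ D' > 0`, (2) `D' > 0 ⟹ D'.ξ₀ + D'.ξ₁ > 0`, (3) `ξ₀.ξ₁ = 1, ξ_j.ξ_j = 0` —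
"show … that the hypothesis (2) of the following simple Lemma 2.1 is fulfilled, and hence that RH
holds", where Lemma 2.1 says: for a symmetric bilinear `s` with (1) `s(ξ_j,ξ_j) = 0, s(ξ₀,ξ₁) = 1` and
(2) `s(x,x) > 0 ⟹ s(x,ξ₀) ≠ 0 ∨ s(x,ξ₁) ≠ 0`, one has `s(x,x) ≤ 2 s(x,ξ₀) s(x,ξ₁)` (Castelnuovo–Severi)
[typed verbatim with its printed proof: `Literature.NumberTheory.Connes2016.Connes2016_lemma_2_1`,
`Connes2016_lemma_2_1_iff` (EssayLemma.lean, 7bdb7e709818); the tree's `inter_self_le_two_mul_of_hodge`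
is the Hodge-hypothesis variant].
On the number-field side the programme DECREES the pairing of its divisors
`D(f) = ∫ f(λ) Ψ_λ d^*λ` through the explicit formula — `D(f)•D(f) := 𝔰(f,f) = N(f ⋆ f̃)`
(arXiv:1805.10501 §3.1 eq. (17), p. 10; Essay normalisation `½ D.D = s(f,f)`, p. 20) — and ASSERTS the
bidegree `(∫ f d^*u, ∫ f du)` (ibid. p. 10: "Ψ_λ is of degree λ", "the degree and codegree of D");
the rulings `ξ₀, ξ₁` themselves are not constructed on any square (cell file `LOCATED-GAP.md`, G6).

This file takes the programme at its word.  For a real test function `u` (`g = u`, `f = toMul u`,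
`𝔰 = ccPairing`, `d₀ = massDstar f = ĝ(0)`, `d₁ = massDu f = ĝ(1)`; `RiemannRochStrategy.lean`,
4b82ff3919c5) and `α β : ℝ`, the FORMAL CLASS `x = D(f) + α ξ₀ + β ξ₁` has, by bilinearity from the
decreed/asserted data and fact (3), the pairings (written out inline in every statement below — no
`Prop` or pairing is minted as a named summit-side object):
* `s(x,x)  = 2 𝔰(f,f) + 2 α d₀ + 2 β d₁ + 2 α β`   (Essay normalisation `D.D = 2𝔰`; `u = 0` gives the
  hyperbolic plane `2αβ`, i.e. fact (3) is built in),
* `s(x,ξ₀) = d₀ + β`,   `s(x,ξ₁) = d₁ + α`.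
PROVED here (no facts, no axioms beyond the standard trio):
* `pencil_csDefect_eq` — `2 s(x,ξ₀) s(x,ξ₁) − s(x,x) = Re Q(g)` for ALL `α, β`: the Castelnuovo–Severi
  defect of every class in the span of `D(f), ξ₀, ξ₁` is Weil's quadratic functional of `g` (it is
  minus the self-intersection of the component of `x` orthogonal to both rulings); the case
  `α = β = 0` is `two_mul_ccPairing_sub_two_mul_masses_eq` of `MotivicDoorCastelnuovoSeveri.lean`;
* `essayHypothesisTwo_iff_weilPositivity`, `essayHypothesisTwo_iff_riemannHypothesis` — hypothesis (2)
  of Lemma 2.1, quantified over all formal classes `D(f) + α ξ₀ + β ξ₁`, is EQUIVALENT to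
  `WeilPositivity`, hence to RH (Weil's criterion `weil_criterion_holds`, Bombieri 2000 Thm. 2 — in
  the tree);
* `pencil_castelnuovoSeveri_iff_weilPositivity` — so is the conclusion of Lemma 2.1 on that span
  (the case `α = β = 0` is `forall_ccPairing_le_masses_iff_weilPositivity`, 62123e51ccb2);
* `essayHypothesisTwo_iff_pencil_castelnuovoSeveri` — Lemma 2.1 and its converse on this span.
READING (the cell's located gap, made kernel-precise): on Connes–Consani's objects Lemma 2.1 has no
slack — its hypothesis (2) already carries the full content of RH; so the Riemann–Roch strategy's whole
burden is to PROVE (2), i.e. to supply fact (1) (an `H⁰` with `Dim_ℝ H⁰(D) > 1 ⟹ D ∼ D' > 0` on a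
square carrying linear equivalence) together with the Riemann–Roch inequality (12) — exactly the objects
absent in print (`LOCATED-GAP.md` §cc-3: G1, G2, G2′, G4, G5).  HONEST FRAMING: lottery ticket at the
motivic door; RH probability negligible; nothing in this file is evidence about RH or a new criterion —
every statement is Weil's criterion rewritten in the Essay's vocabulary.

References: A. Connes 2016 §2.3 Lemma 2.1 and facts 1–3, p. 8; §4.1 pp. 20–21 [Connes2016EssayRH];
A. Connes, C. Consani 2019 §3.1 eqs. (15)–(17) p. 10 [ConnesConsani2019RiemannRochStrategy];
E. Bombieri 2000 Thm. 2 [Bombieri2000Weil].  Companion files of this seat: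
`MotivicDoorCastelnuovoSeveri.lean` (62123e51ccb2: the case `α = β = 0`, imported),
`MotivicDoorCC2019Criterion.lean` (16db9eaf0d61: eq. (15) discharged).
-/

noncomputable section

set_option linter.dupNamespace false

namespace Summit.RiemannHypothesis.RiemannHypothesis.Theorems.MotivicDoor.ConnesConsani

open Complex Set MeasureTheory
open scoped ComplexConjugate
open Literature.NumberTheory.LFunctions Literature.NumberTheory.ConnesConsani2019

/-! ## The Castelnuovo–Severi defect of every formal class `D(f) + α ξ₀ + β ξ₁` is `Re Q(g)` -/

/-- **Defect invariance.**  For every real test `u` (`f = toMul u`, `d₀ = ∫ f d^*x`, `d₁ = ∫ f dx`)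
and all `α β : ℝ`, with `s(x,ξ₀) = d₀ + β`, `s(x,ξ₁) = d₁ + α`,
`s(x,x) = 2𝔰(f,f) + 2αd₀ + 2βd₁ + 2αβ` the decreed pairings of `x = D(f) + α ξ₀ + β ξ₁`:
`2 s(x,ξ₀) s(x,ξ₁) − s(x,x) = Re Q(g)` — adjoining rulings never changes the Castelnuovo–Severi
defect, which is Weil's quadratic functional of `g`. -/
theorem pencil_csDefect_eq {u : ℝ → ℝ} (hu : IsWeilTest (fun t ↦ (u t : ℂ))) (α β : ℝ) :
    2 * (massDstar (toMul u) + β) * (massDu (toMul u) + α) -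
        (2 * ccPairing (toMul u) (toMul u) + 2 * α * massDstar (toMul u) +
          2 * β * massDu (toMul u) + 2 * α * β) =
      (weilQuadratic fun t ↦ (u t : ℂ)).re := by
  have h := two_mul_ccPairing_sub_two_mul_masses_eq hu
  linarith

/-! ## Hypothesis (2) of Lemma 2.1 on the span of `D(f), ξ₀, ξ₁` ⟺ Weil positivity ⟺ RH -/

/-- **Hypothesis (2) ⟺ Weil positivity.**  Hypothesis (2) of the Essay's Lemma 2.1 —
"`s(x,x) > 0 ⟹ s(x,ξ₀) ≠ 0 ∨ s(x,ξ₁) ≠ 0`" — quantified over every formal class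
`x = D(f) + α ξ₀ + β ξ₁` (`f = toMul u`, `u` a real test function; pairings as in
`pencil_csDefect_eq`) holds iff `WeilPositivity`.  (⇒) at the class orthogonal to both rulings,
`α = −∫ f dx`, `β = −∫ f d^*x`, hypothesis (2) forces `s(x,x) ≤ 0`, i.e. `Re Q(g) ≥ 0`;
(⇐) if `Re Q(g) ≥ 0` then `2 s(x,ξ₀)s(x,ξ₁) ≥ s(x,x) > 0` forces both factors non-zero. -/
theorem essayHypothesisTwo_iff_weilPositivity :
    (∀ u : ℝ → ℝ, IsWeilTest (fun t ↦ (u t : ℂ)) → ∀ α β : ℝ,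
        0 < 2 * ccPairing (toMul u) (toMul u) + 2 * α * massDstar (toMul u) +
              2 * β * massDu (toMul u) + 2 * α * β →
          massDstar (toMul u) + β ≠ 0 ∨ massDu (toMul u) + α ≠ 0) ↔ WeilPositivity := by
  rw [weilPositivity_iff_real]
  constructor
  · intro h u hu
    have hd := pencil_csDefect_eq hu (-massDu (toMul u)) (-massDstar (toMul u))
    have hle : 2 * ccPairing (toMul u) (toMul u) + 2 * (-massDu (toMul u)) * massDstar (toMul u) +
        2 * (-massDstar (toMul u)) * massDu (toMul u) +
          2 * (-massDu (toMul u)) * (-massDstar (toMul u)) ≤ 0 := by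
      by_contra hpos
      rcases h u hu _ _ (lt_of_not_ge hpos) with h' | h'
      · exact h' (by ring)
      · exact h' (by ring)
    nlinarith [hd, hle]
  · intro h u hu α β hpos
    have hd := pencil_csDefect_eq hu α β
    have hq := h u hu
    have hprod : 0 < (massDstar (toMul u) + β) * (massDu (toMul u) + α) := by nlinarith
    left
    intro h0
    rw [h0, zero_mul] at hprod
    exact lt_irrefl _ hprod

/-- **Hypothesis (2) ⟺ RH** (through Weil's criterion `weil_criterion_holds`, Bombieri 2000 Thm. 2 —
in the tree; nothing new about RH).  The Riemann–Roch strategy's entire burden is therefore to PROVE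
hypothesis (2) — via fact (1) and the Riemann–Roch inequality (12), the objects print does not have. -/
theorem essayHypothesisTwo_iff_riemannHypothesis :
    (∀ u : ℝ → ℝ, IsWeilTest (fun t ↦ (u t : ℂ)) → ∀ α β : ℝ,
        0 < 2 * ccPairing (toMul u) (toMul u) + 2 * α * massDstar (toMul u) +
              2 * β * massDu (toMul u) + 2 * α * β →
          massDstar (toMul u) + β ≠ 0 ∨ massDu (toMul u) + α ≠ 0) ↔ _root_.RiemannHypothesis :=
  essayHypothesisTwo_iff_weilPositivity.trans
    (show _root_.RiemannHypothesis ↔ WeilPositivity from weil_criterion_holds).symm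

/-- **Castelnuovo–Severi on the whole span ⟺ Weil positivity**: `s(x,x) ≤ 2 s(x,ξ₀) s(x,ξ₁)` for every
formal class `D(f) + α ξ₀ + β ξ₁` iff `WeilPositivity` (the case `α = β = 0` is
`forall_ccPairing_le_masses_iff_weilPositivity`). -/
theorem pencil_castelnuovoSeveri_iff_weilPositivity :
    (∀ u : ℝ → ℝ, IsWeilTest (fun t ↦ (u t : ℂ)) → ∀ α β : ℝ,
        2 * ccPairing (toMul u) (toMul u) + 2 * α * massDstar (toMul u) +
            2 * β * massDu (toMul u) + 2 * α * β ≤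
          2 * (massDstar (toMul u) + β) * (massDu (toMul u) + α)) ↔ WeilPositivity := by
  rw [weilPositivity_iff_real]
  refine ⟨fun h u hu ↦ ?_, fun h u hu α β ↦ ?_⟩
  · have hd := pencil_csDefect_eq hu 0 0
    linarith [h u hu 0 0]
  · have hd := pencil_csDefect_eq hu α β
    linarith [h u hu]

/-- Lemma 2.1 and its converse on this span, as one statement: hypothesis (2) ⟺ Castelnuovo–Severi
for every formal class `D(f) + α ξ₀ + β ξ₁` (both sides being Weil positivity). -/
theorem essayHypothesisTwo_iff_pencil_castelnuovoSeveri :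
    (∀ u : ℝ → ℝ, IsWeilTest (fun t ↦ (u t : ℂ)) → ∀ α β : ℝ,
        0 < 2 * ccPairing (toMul u) (toMul u) + 2 * α * massDstar (toMul u) +
              2 * β * massDu (toMul u) + 2 * α * β →
          massDstar (toMul u) + β ≠ 0 ∨ massDu (toMul u) + α ≠ 0) ↔
      ∀ u : ℝ → ℝ, IsWeilTest (fun t ↦ (u t : ℂ)) → ∀ α β : ℝ,
        2 * ccPairing (toMul u) (toMul u) + 2 * α * massDstar (toMul u) +
            2 * β * massDu (toMul u) + 2 * α * β ≤
          2 * (massDstar (toMul u) + β) * (massDu (toMul u) + α) :=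
  essayHypothesisTwo_iff_weilPositivity.trans pencil_castelnuovoSeveri_iff_weilPositivity.symm

end Summit.RiemannHypothesis.RiemannHypothesis.Theorems.MotivicDoor.ConnesConsani
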